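import Summits.QuantumFields.YangMills.Theorems.ScalingWindowSplitSelfNormalisedSkewnessStubWickSquares
import HarnessLib

/-!
# Crux `SelfNormalisedSkewness` (stmt-QuantumFields-18944, line `Sketch`): stub W3-2 —
# moments and Markov tails of Parseval-frame quadratic forms under the standard Gaussian

Let `γ = stdGaussian W` be the standard Gaussian of a finite-dimensional real inner product space
`W`, and let `a : P → W` be a Parseval frame, `∑ p, ⟪a p, v⟫² = ‖v‖²`.  Then `‖a p‖ ≤ 1` for every
`p`, so every coordinate `⟪a p, ·⟫` is a centred Gaussian of variance `≤ 1` with even moments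
`≤ (2r-1)‼` (`integral_inner_pow_even_stdGaussian` of the Wick-squares stub file).  For finsets
`A, B, D` of cardinality `≤ 6` the quadratic forms `Q_A = ∑_{p ∈ A} ⟪a p, ·⟫²` and their products are
dominated pointwise by a power of the largest squared coordinate, hence by a sum of pure even
powers ("the largest coordinate dominates"): this gives integrability, absolute bounds on
`E[Q_A Q_B]`, `E[Q_A Q_B Q_D]`, and — since on the tail event `{∃ p, t ≤ |⟪a p, x⟫|}` the largest
squared coordinate is `≥ t²` — Markov-type tail bounds of order `card P · t⁻⁶`, all with one
absolute constant.
-/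

noncomputable section

open MeasureTheory ProbabilityTheory
open scoped InnerProductSpace Nat ENNReal BigOperators

namespace Summit.QuantumFields.YangMills.Theorems.SelfNormalisedSkewness.Negative

section ParsevalGaussianMomentsHelpers

variable {W : Type*} [NormedAddCommGroup W] [InnerProductSpace ℝ W] [FiniteDimensional ℝ W]
  [MeasurableSpace W] [BorelSpace W] {P : Type*}

omit [FiniteDimensional ℝ W] [MeasurableSpace W] [BorelSpace W] in
/-- The vectors of a Parseval frame have norm at most one: `‖a q‖⁴ = ⟪a q, a q⟫² ≤ ∑ p, ⟪a p, a q⟫² =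
‖a q‖²`. [folklore] -/
theorem norm_sq_le_one_of_frame [Fintype P] (a : P → W)
    (hframe : ∀ v : W, ∑ p, ⟪a p, v⟫_ℝ ^ 2 = ‖v‖ ^ 2) (q : P) : ‖a q‖ ^ 2 ≤ 1 := by
  have h1 : (‖a q‖ ^ 2) ^ 2 ≤ ‖a q‖ ^ 2 :=
    calc (‖a q‖ ^ 2) ^ 2 = ⟪a q, a q⟫_ℝ ^ 2 := by rw [real_inner_self_eq_norm_sq]
      _ ≤ ∑ p, ⟪a p, a q⟫_ℝ ^ 2 :=
        Finset.single_le_sum (f := fun p => ⟪a p, a q⟫_ℝ ^ 2) (fun p _ => sq_nonneg _)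
          (Finset.mem_univ q)
      _ = ‖a q‖ ^ 2 := hframe (a q)
  nlinarith [h1, sq_nonneg (‖a q‖ ^ 2 - 1)]

omit [FiniteDimensional ℝ W] [MeasurableSpace W] [BorelSpace W] in
/-- A quadratic form over at most six frame coordinates is at most six times any common bound of the
squared coordinates. [folklore] -/
theorem sum_sq_le_six_mul (a : P → W) {A S : Finset P} (hAS : A ⊆ S) (hA : A.card ≤ 6) {x : W}
    {M : ℝ} (hM : 0 ≤ M) (h : ∀ q ∈ S, ⟪a q, x⟫_ℝ ^ 2 ≤ M) :
    ∑ p ∈ A, ⟪a p, x⟫_ℝ ^ 2 ≤ 6 * M :=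
  calc ∑ p ∈ A, ⟪a p, x⟫_ℝ ^ 2 ≤ ∑ p ∈ A, M := Finset.sum_le_sum fun p hp => h p (hAS hp)
    _ = A.card * M := by rw [Finset.sum_const, nsmul_eq_mul]
    _ ≤ 6 * M := mul_le_mul_of_nonneg_right (by exact_mod_cast hA) hM

/-- **The largest coordinate dominates (moments).**  If a continuous `ψ ≥ 0` satisfies
`ψ x ≤ K M^k` whenever `M ≥ 0` bounds the squared coordinates `⟪a q, x⟫²`, `q ∈ S`, of frame vectors
of norm `≤ 1`, then `ψ` is `γ`-integrable with `∫ ψ dγ ≤ K · card S · (2k-1)‼` (`k ≥ 1`). [folklore] -/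
theorem integrable_and_integral_le_of_dom (a : P → W) {S : Finset P}
    (hnorm : ∀ q ∈ S, ‖a q‖ ^ 2 ≤ 1) {ψ : W → ℝ} (hψc : Continuous ψ) (hψ0 : ∀ x, 0 ≤ ψ x)
    {K : ℝ} (hK : 0 ≤ K) {k : ℕ} (hk : 1 ≤ k)
    (hdom : ∀ (x : W) (M : ℝ), 0 ≤ M → (∀ q ∈ S, ⟪a q, x⟫_ℝ ^ 2 ≤ M) → ψ x ≤ K * M ^ k) :
    Integrable ψ (stdGaussian W) ∧
      ∫ x, ψ x ∂stdGaussian W ≤ K * S.card * ((2 * k - 1 : ℕ)‼ : ℝ) := by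
  -- pointwise domination by pure even powers of the coordinates
  have hpt : ∀ x, ψ x ≤ K * ∑ q ∈ S, ⟪a q, x⟫_ℝ ^ (2 * k) := by
    intro x
    rcases S.eq_empty_or_nonempty with hS | hS
    · have h := hdom x 0 le_rfl (by simp [hS])
      simpa [hS, zero_pow (by omega : k ≠ 0)] using h
    · obtain ⟨q₀, hq₀, hmax⟩ := S.exists_max_image (fun q => ⟪a q, x⟫_ℝ ^ 2) hS
      calc ψ x ≤ K * (⟪a q₀, x⟫_ℝ ^ 2) ^ k := hdom x _ (sq_nonneg _) hmax
        _ = K * ⟪a q₀, x⟫_ℝ ^ (2 * k) := by rw [pow_mul]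
        _ ≤ K * ∑ q ∈ S, ⟪a q, x⟫_ℝ ^ (2 * k) :=
          mul_le_mul_of_nonneg_left (Finset.single_le_sum (f := fun q => ⟪a q, x⟫_ℝ ^ (2 * k))
            (fun q _ => (even_two_mul k).pow_nonneg _) hq₀) hK
  have hg : Integrable (fun x : W => K * ∑ q ∈ S, ⟪a q, x⟫_ℝ ^ (2 * k)) (stdGaussian W) :=
    (integrable_finsetSum S fun q _ => integrable_inner_pow_stdGaussian (a q) (2 * k)).const_mul K
  have hψi : Integrable ψ (stdGaussian W) :=
    hg.mono' hψc.aestronglyMeasurable (ae_of_all _ fun x => by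
      rw [Real.norm_eq_abs, abs_of_nonneg (hψ0 x)]; exact hpt x)
  refine ⟨hψi, ?_⟩
  calc ∫ x, ψ x ∂stdGaussian W ≤ ∫ x, K * ∑ q ∈ S, ⟪a q, x⟫_ℝ ^ (2 * k) ∂stdGaussian W :=
        integral_mono hψi hg hpt
    _ = K * ∑ q ∈ S, (‖a q‖ ^ 2) ^ k * ((2 * k - 1 : ℕ)‼ : ℝ) := by
        rw [integral_const_mul,
          integral_finsetSum S fun q _ => integrable_inner_pow_stdGaussian (a q) (2 * k)]
        simp_rw [integral_inner_pow_even_stdGaussian]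
    _ ≤ K * ∑ q ∈ S, (1 : ℝ) ^ k * ((2 * k - 1 : ℕ)‼ : ℝ) := by
        gcongr with q hq
        exact hnorm q hq
    _ = K * S.card * ((2 * k - 1 : ℕ)‼ : ℝ) := by
        rw [Finset.sum_const, nsmul_eq_mul]; ring

/-- **The largest coordinate dominates (tails).**  If `ψ ≥ 0` satisfies `ψ x ≤ K M^k` whenever
`M ≥ 0` bounds all squared coordinates `⟪a q, x⟫²` of frame vectors of norm `≤ 1`, then on the tail
event `{∃ p, t ≤ |⟪a p, x⟫|}` (`t ≥ 1`), where the largest squared coordinate is `≥ t²`, Markov's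
inequality gives `∫_{tail} ψ dγ ≤ K (2k+5)‼ · card P · t⁻⁶`. [folklore] -/
theorem setIntegral_tail_le_of_dom [Fintype P] (a : P → W) (hnorm : ∀ q, ‖a q‖ ^ 2 ≤ 1)
    {ψ : W → ℝ} (hψ0 : ∀ x, 0 ≤ ψ x) {K : ℝ} (hK : 0 ≤ K) {k : ℕ}
    (hdom : ∀ (x : W) (M : ℝ), 0 ≤ M → (∀ q, ⟪a q, x⟫_ℝ ^ 2 ≤ M) → ψ x ≤ K * M ^ k)
    {t : ℝ} (ht : 1 ≤ t) :
    ∫ x in {x : W | ∃ p, t ≤ |⟪a p, x⟫_ℝ|}, ψ x ∂stdGaussian W ≤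
      K * ((2 * (k + 3) - 1 : ℕ)‼ : ℝ) * Fintype.card P * t⁻¹ ^ 6 := by
  have hT : MeasurableSet {x : W | ∃ p, t ≤ |⟪a p, x⟫_ℝ|} := by
    rw [Set.setOf_exists]
    exact MeasurableSet.iUnion fun p =>
      (isClosed_le continuous_const ((continuous_const.inner continuous_id).abs)).measurableSet
  have ht0 : 0 < t := by linarith
  have hg : Integrable (fun x : W => K * t⁻¹ ^ 6 * ∑ q, ⟪a q, x⟫_ℝ ^ (2 * (k + 3)))
      (stdGaussian W) :=
    (integrable_finsetSum _ fun q _ => integrable_inner_pow_stdGaussian (a q) _).const_mul _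
  have hpt : ∀ x, {x : W | ∃ p, t ≤ |⟪a p, x⟫_ℝ|}.indicator ψ x ≤
      K * t⁻¹ ^ 6 * ∑ q, ⟪a q, x⟫_ℝ ^ (2 * (k + 3)) := by
    intro x
    by_cases hx : x ∈ {x : W | ∃ p, t ≤ |⟪a p, x⟫_ℝ|}
    · rw [Set.indicator_of_mem hx]
      have hx' : ∃ p, t ≤ |⟪a p, x⟫_ℝ| := hx
      obtain ⟨p, hp⟩ := hx'
      haveI : Nonempty P := ⟨p⟩
      obtain ⟨q₀, -, hmax⟩ :=
        Finset.univ.exists_max_image (fun q => ⟪a q, x⟫_ℝ ^ 2) Finset.univ_nonempty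
      have htM : t ^ 2 ≤ ⟪a q₀, x⟫_ℝ ^ 2 :=
        calc t ^ 2 ≤ |⟪a p, x⟫_ℝ| ^ 2 := pow_le_pow_left₀ ht0.le hp 2
          _ = ⟪a p, x⟫_ℝ ^ 2 := sq_abs _
          _ ≤ ⟪a q₀, x⟫_ℝ ^ 2 := hmax p (Finset.mem_univ p)
      have h1 : 1 ≤ t⁻¹ ^ 2 * ⟪a q₀, x⟫_ℝ ^ 2 :=
        calc (1 : ℝ) = t⁻¹ ^ 2 * t ^ 2 := by field_simp
          _ ≤ t⁻¹ ^ 2 * ⟪a q₀, x⟫_ℝ ^ 2 := mul_le_mul_of_nonneg_left htM (by positivity)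
      calc ψ x ≤ K * (⟪a q₀, x⟫_ℝ ^ 2) ^ k :=
            hdom x _ (sq_nonneg _) fun q => hmax q (Finset.mem_univ q)
        _ = K * (⟪a q₀, x⟫_ℝ ^ 2) ^ k * 1 := (mul_one _).symm
        _ ≤ K * (⟪a q₀, x⟫_ℝ ^ 2) ^ k * (t⁻¹ ^ 2 * ⟪a q₀, x⟫_ℝ ^ 2) ^ 3 :=
            mul_le_mul_of_nonneg_left (one_le_pow₀ h1) (by positivity)
        _ = K * t⁻¹ ^ 6 * ⟪a q₀, x⟫_ℝ ^ (2 * (k + 3)) := by ring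
        _ ≤ K * t⁻¹ ^ 6 * ∑ q, ⟪a q, x⟫_ℝ ^ (2 * (k + 3)) :=
            mul_le_mul_of_nonneg_left
              (Finset.single_le_sum (f := fun q => ⟪a q, x⟫_ℝ ^ (2 * (k + 3)))
                (fun q _ => (even_two_mul _).pow_nonneg _) (Finset.mem_univ q₀)) (by positivity)
    · rw [Set.indicator_of_notMem hx]
      exact mul_nonneg (by positivity) (Finset.sum_nonneg fun q _ => (even_two_mul _).pow_nonneg _)
  calc ∫ x in {x : W | ∃ p, t ≤ |⟪a p, x⟫_ℝ|}, ψ x ∂stdGaussian W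
        = ∫ x, {x : W | ∃ p, t ≤ |⟪a p, x⟫_ℝ|}.indicator ψ x ∂stdGaussian W :=
          (integral_indicator hT).symm
    _ ≤ ∫ x, K * t⁻¹ ^ 6 * ∑ q, ⟪a q, x⟫_ℝ ^ (2 * (k + 3)) ∂stdGaussian W :=
          integral_mono_of_nonneg (ae_of_all _ (Set.indicator_nonneg fun y _ => hψ0 y)) hg
            (ae_of_all _ hpt)
    _ = K * t⁻¹ ^ 6 * ∑ q, (‖a q‖ ^ 2) ^ (k + 3) * ((2 * (k + 3) - 1 : ℕ)‼ : ℝ) := by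
          rw [integral_const_mul,
            integral_finsetSum _ fun q _ => integrable_inner_pow_stdGaussian (a q) _]
          simp_rw [integral_inner_pow_even_stdGaussian]
    _ ≤ K * t⁻¹ ^ 6 * ∑ _q : P, (1 : ℝ) ^ (k + 3) * ((2 * (k + 3) - 1 : ℕ)‼ : ℝ) := by
          gcongr with q _
          exact hnorm q
    _ = K * ((2 * (k + 3) - 1 : ℕ)‼ : ℝ) * Fintype.card P * t⁻¹ ^ 6 := by
          rw [Finset.sum_const, Finset.card_univ, nsmul_eq_mul]; ring

end ParsevalGaussianMomentsHelpers

/-- **Stub W3-2 — moments and Markov tails of frame quadratic forms under the standard Gaussian**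
(line `Sketch` of crux `SelfNormalisedSkewness`, registered signature verbatim).  For a Parseval frame
`a : P → W` (`∑ p, ⟪a p, v⟫² = ‖v‖²`) of a finite-dimensional real inner product space with standard
Gaussian `γ`, and finsets `A, B, D` of cardinality `≤ 6`, the quadratic forms
`Q_A = ∑_{p∈A} ⟪a p, ·⟫²` satisfy: `Q_A`, `Q_A Q_B`, `Q_A Q_B Q_D` are `γ`-integrable, `∫ Q_A ≤ 6`,
`∫ Q_A Q_B ≤ C`, `∫ Q_A Q_B Q_D ≤ C`, and for `t ≥ 1` the tail event `T_t = {∃ p, t ≤ |⟪a p, x⟫|}` has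
`γ(T_t)`, `∫_{T_t} Q_A`, `∫_{T_t} Q_A Q_B`, `∫_{T_t} Q_A Q_B Q_D` all `≤ C · card P · t⁻⁶`, with one
absolute constant `C` (here `C = 216 · 11‼ = 2245320`). [folklore] -/
theorem stub_parsevalGaussianMoments : ∃ C : ℝ, 0 < C ∧ ∀ {W : Type} [NormedAddCommGroup W]
    [InnerProductSpace ℝ W] [FiniteDimensional ℝ W] [MeasurableSpace W] [BorelSpace W] {P : Type}
    [Fintype P] (a : P → W), (∀ v : W, ∑ p, ⟪a p, v⟫_ℝ ^ 2 = ‖v‖ ^ 2) →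
    ∀ (A B D : Finset P), A.card ≤ 6 → B.card ≤ 6 → D.card ≤ 6 →
    Integrable (fun x : W => ∑ p ∈ A, ⟪a p, x⟫_ℝ ^ 2) (stdGaussian W) ∧
    Integrable (fun x : W => (∑ p ∈ A, ⟪a p, x⟫_ℝ ^ 2) * (∑ p ∈ B, ⟪a p, x⟫_ℝ ^ 2)) (stdGaussian W) ∧
    Integrable (fun x : W => (∑ p ∈ A, ⟪a p, x⟫_ℝ ^ 2) * (∑ p ∈ B, ⟪a p, x⟫_ℝ ^ 2) * (∑ p ∈ D, ⟪a p, x⟫_ℝ ^ 2))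
      (stdGaussian W) ∧
    (∫ x, (∑ p ∈ A, ⟪a p, x⟫_ℝ ^ 2) ∂(stdGaussian W) ≤ 6) ∧
    (∫ x, (∑ p ∈ A, ⟪a p, x⟫_ℝ ^ 2) * (∑ p ∈ B, ⟪a p, x⟫_ℝ ^ 2) ∂(stdGaussian W) ≤ C) ∧
    (∫ x, (∑ p ∈ A, ⟪a p, x⟫_ℝ ^ 2) * (∑ p ∈ B, ⟪a p, x⟫_ℝ ^ 2) * (∑ p ∈ D, ⟪a p, x⟫_ℝ ^ 2) ∂(stdGaussian W)
      ≤ C) ∧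
    (∀ t : ℝ, 1 ≤ t →
      (stdGaussian W).real {x : W | ∃ p, t ≤ |⟪a p, x⟫_ℝ|} ≤ C * Fintype.card P * t⁻¹ ^ 6 ∧
      ∫ x in {x : W | ∃ p, t ≤ |⟪a p, x⟫_ℝ|}, (∑ p ∈ A, ⟪a p, x⟫_ℝ ^ 2) ∂(stdGaussian W) ≤
        C * Fintype.card P * t⁻¹ ^ 6 ∧
      ∫ x in {x : W | ∃ p, t ≤ |⟪a p, x⟫_ℝ|}, (∑ p ∈ A, ⟪a p, x⟫_ℝ ^ 2) * (∑ p ∈ B, ⟪a p, x⟫_ℝ ^ 2)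
        ∂(stdGaussian W) ≤ C * Fintype.card P * t⁻¹ ^ 6 ∧
      ∫ x in {x : W | ∃ p, t ≤ |⟪a p, x⟫_ℝ|},
        (∑ p ∈ A, ⟪a p, x⟫_ℝ ^ 2) * (∑ p ∈ B, ⟪a p, x⟫_ℝ ^ 2) * (∑ p ∈ D, ⟪a p, x⟫_ℝ ^ 2) ∂(stdGaussian W) ≤
        C * Fintype.card P * t⁻¹ ^ 6) := by
  refine ⟨2245320, by norm_num, ?_⟩
  intro W _ _ _ _ _ P _ a hframe A B D hA hB hD
  classical
  have hnorm : ∀ q, ‖a q‖ ^ 2 ≤ 1 := norm_sq_le_one_of_frame a hframe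
  -- nonnegativity of the quadratic forms
  have hQ0 : ∀ (S : Finset P) (x : W), 0 ≤ ∑ p ∈ S, ⟪a p, x⟫_ℝ ^ 2 :=
    fun S x => Finset.sum_nonneg fun p _ => sq_nonneg _
  -- cardinalities of the supports
  have hAB : ((A ∪ B).card : ℝ) ≤ 12 := by
    exact_mod_cast (Finset.card_union_le A B).trans (by omega)
  have hABD : ((A ∪ B ∪ D).card : ℝ) ≤ 18 := by
    exact_mod_cast ((Finset.card_union_le _ D).trans
      (Nat.add_le_add_right (Finset.card_union_le A B) _)).trans (by omega)
  -- domination of the quadratic forms by powers of the largest squared coordinate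
  have hdom1 : ∀ (x : W) (M : ℝ), 0 ≤ M → (∀ q ∈ A, ⟪a q, x⟫_ℝ ^ 2 ≤ M) →
      ∑ p ∈ A, ⟪a p, x⟫_ℝ ^ 2 ≤ 6 * M ^ 1 := fun x M hM h => by
    rw [pow_one]; exact sum_sq_le_six_mul a subset_rfl hA hM h
  have hdom2 : ∀ (x : W) (M : ℝ), 0 ≤ M → (∀ q ∈ A ∪ B, ⟪a q, x⟫_ℝ ^ 2 ≤ M) →
      (∑ p ∈ A, ⟪a p, x⟫_ℝ ^ 2) * (∑ p ∈ B, ⟪a p, x⟫_ℝ ^ 2) ≤ 36 * M ^ 2 := by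
    intro x M hM h
    calc (∑ p ∈ A, ⟪a p, x⟫_ℝ ^ 2) * (∑ p ∈ B, ⟪a p, x⟫_ℝ ^ 2) ≤ (6 * M) * (6 * M) :=
          mul_le_mul (sum_sq_le_six_mul a Finset.subset_union_left hA hM h)
            (sum_sq_le_six_mul a Finset.subset_union_right hB hM h) (hQ0 B x) (by positivity)
      _ = 36 * M ^ 2 := by ring
  have hdom3 : ∀ (x : W) (M : ℝ), 0 ≤ M → (∀ q ∈ A ∪ B ∪ D, ⟪a q, x⟫_ℝ ^ 2 ≤ M) →
      (∑ p ∈ A, ⟪a p, x⟫_ℝ ^ 2) * (∑ p ∈ B, ⟪a p, x⟫_ℝ ^ 2) * (∑ p ∈ D, ⟪a p, x⟫_ℝ ^ 2) ≤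
        216 * M ^ 3 := by
    intro x M hM h
    calc (∑ p ∈ A, ⟪a p, x⟫_ℝ ^ 2) * (∑ p ∈ B, ⟪a p, x⟫_ℝ ^ 2) * (∑ p ∈ D, ⟪a p, x⟫_ℝ ^ 2) ≤
        (6 * M) * (6 * M) * (6 * M) :=
          mul_le_mul (mul_le_mul
            (sum_sq_le_six_mul a (Finset.subset_union_left.trans Finset.subset_union_left) hA hM h)
            (sum_sq_le_six_mul a (Finset.subset_union_right.trans Finset.subset_union_left) hB hM h)
            (hQ0 B x) (by positivity))
            (sum_sq_le_six_mul a Finset.subset_union_right hD hM h) (hQ0 D x) (by positivity)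
      _ = 216 * M ^ 3 := by ring
  -- moments
  have hI1 : Integrable (fun x : W => ∑ p ∈ A, ⟪a p, x⟫_ℝ ^ 2) (stdGaussian W) :=
    integrable_finsetSum A fun p _ => integrable_inner_pow_stdGaussian (a p) 2
  have hE1 : ∫ x, (∑ p ∈ A, ⟪a p, x⟫_ℝ ^ 2) ∂(stdGaussian W) ≤ 6 := by
    rw [integral_finsetSum A fun p _ => integrable_inner_pow_stdGaussian (a p) 2]
    simp_rw [integral_inner_sq_stdGaussian]
    calc ∑ p ∈ A, ‖a p‖ ^ 2 ≤ ∑ _p ∈ A, (1 : ℝ) := Finset.sum_le_sum fun p _ => hnorm p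
      _ = A.card := by rw [Finset.sum_const, nsmul_eq_mul, mul_one]
      _ ≤ 6 := by exact_mod_cast hA
  obtain ⟨hI2, hE2⟩ := integrable_and_integral_le_of_dom a (fun q _ => hnorm q) (by fun_prop)
    (fun x => mul_nonneg (hQ0 A x) (hQ0 B x)) (by norm_num : (0 : ℝ) ≤ 36) (by norm_num : 1 ≤ 2)
    hdom2
  obtain ⟨hI3, hE3⟩ := integrable_and_integral_le_of_dom a (fun q _ => hnorm q) (by fun_prop)
    (fun x => mul_nonneg (mul_nonneg (hQ0 A x) (hQ0 B x)) (hQ0 D x)) (by norm_num : (0 : ℝ) ≤ 216)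
    (by norm_num : 1 ≤ 3) hdom3
  refine ⟨hI1, hI2, hI3, hE1, hE2.trans ?_, hE3.trans ?_, fun t ht => ⟨?_, ?_, ?_, ?_⟩⟩
  · have h : ((2 * 2 - 1 : ℕ)‼ : ℝ) = 3 := by norm_num [Nat.doubleFactorial]
    rw [h]; linarith [hAB]
  · have h : ((2 * 3 - 1 : ℕ)‼ : ℝ) = 15 := by norm_num [Nat.doubleFactorial]
    rw [h]; linarith [hABD]
  · -- the tail probability: `ψ = 1`
    have h0 := setIntegral_tail_le_of_dom a hnorm (ψ := fun _ => (1 : ℝ)) (fun _ => zero_le_one)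
      zero_le_one (k := 0) (fun x M _ _ => by rw [pow_zero, mul_one]) ht
    rw [setIntegral_const, smul_eq_mul, mul_one] at h0
    refine h0.trans (mul_le_mul_of_nonneg_right (mul_le_mul_of_nonneg_right ?_ (Nat.cast_nonneg _))
      (by positivity))
    norm_num [Nat.doubleFactorial]
  · have h1 := setIntegral_tail_le_of_dom a hnorm (hQ0 A) (by norm_num : (0 : ℝ) ≤ 6) (k := 1)
      (fun x M hM h => hdom1 x M hM fun q _ => h q) ht
    refine h1.trans (mul_le_mul_of_nonneg_right (mul_le_mul_of_nonneg_right ?_ (Nat.cast_nonneg _))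
      (by positivity))
    norm_num [Nat.doubleFactorial]
  · have h2 := setIntegral_tail_le_of_dom a hnorm (fun x => mul_nonneg (hQ0 A x) (hQ0 B x))
      (by norm_num : (0 : ℝ) ≤ 36) (k := 2) (fun x M hM h => hdom2 x M hM fun q _ => h q) ht
    refine h2.trans (mul_le_mul_of_nonneg_right (mul_le_mul_of_nonneg_right ?_ (Nat.cast_nonneg _))
      (by positivity))
    norm_num [Nat.doubleFactorial]
  · have h3 := setIntegral_tail_le_of_dom a hnorm
      (fun x => mul_nonneg (mul_nonneg (hQ0 A x) (hQ0 B x)) (hQ0 D x))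
      (by norm_num : (0 : ℝ) ≤ 216) (k := 3) (fun x M hM h => hdom3 x M hM fun q _ => h q) ht
    refine h3.trans (mul_le_mul_of_nonneg_right (mul_le_mul_of_nonneg_right ?_ (Nat.cast_nonneg _))
      (by positivity))
    norm_num [Nat.doubleFactorial]

end Summit.QuantumFields.YangMills.Theorems.SelfNormalisedSkewness.Negative

end
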